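import Summits.Ventures.WeilGRH.UniformConductorFloorCoprimeFloors57
import Summits.Ventures.WeilGRH.UniformConductorFloorPrincipalDominates
import Summits.Ventures.WeilGRH.UniformConductorFloorPrincipalMod18
import Summits.Ventures.WeilGRH.UniformConductorFloorPrincipalMod32
import HarnessLib

/-!
# GRH arm (rh-explicit, venture WeilGRH): ★★★ Weil positivity on `[-1, 1]` for ALL characters of a modulus — the COMPLETE decision,
  every modulus `q ≥ 2`

Cell `rh-explicit`, WEIL TRACK — GRH ARM (weil-grh-1, gen8).  `U(q)` := «every Dirichlet character `χ` mod `q` satisfies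
`WeilPositivityOnChar χ 1`» (Weil's hermitian form of `L(s, χ)` — no polar term for `q ≠ 1` — non-negative on every smooth test
function supported in `[-1, 1]`).

**THEOREM (`forall_weilPositivityOnChar_one_iff`).**  For every modulus `q ≥ 2`:

  `U(q)  ↔  q ∉ F`,  `F = {2, …, 17, 19, …, 23, 25, …, 29, 31, 33, 35, 37, 39, 41, 43, 47, 49, 53, 55, 59, 61, 67, 71, 73}` (42 moduli).

Assembly of: the floors (gen6 uniform `78`/`31`, gen7 levels `2, 3, 6`, gen8 levels `5, 7, 10, 15` — `UniformConductorFloorCoprimeFloors57`: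
the decision outside `{18, 32}`); the refutations (`UniformConductorFloorPrincipal`: on `F` the principal character fails, flat window);
the structure theorem (`UniformConductorFloorPrincipalDominates`: `U(q) ↔` positivity of the principal character); and the two kernel
cells `UniformConductorFloorPrincipalMod18` / `…Mod32` (the principal characters mod `18` and `32` ARE Weil-positive on `[-1, 1]`:
character-weighted door E, margins `0.0036` / `0.0011`).  So at the window `t = 1` the all-characters statement is decided for EVERY
modulus, the answer is the explicit finite set `F`, the obstruction on `F` is always the principal character, and `U(q)` holds for
every `q ≥ 74` (`73` sharp) and for prime `q` iff `q ≥ 79`.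

Nothing here bears on GRH for any individual character; RH/GRH-free; standard axioms.

## References

* A. Weil, *Sur les "formules explicites" de la théorie des nombres premiers* (1952), (11) pp. 261–262 and the «lemme»
  p. 262. [Weil1952FormulesExplicites]
* H. Yoshida, *On Hermitian forms attached to zeta functions*, Adv. Stud. Pure Math. 21 (1992) 281–325. [Yoshida1992HermitianForms]
-/

set_option autoImplicit false

noncomputable section

namespace Summit.Ventures.WeilGRH

open Literature.NumberTheory.LFunctions

namespace UniformFloor

variable {q : ℕ}

/-- ★ **`U(18)`: every Dirichlet character mod 18 is Weil-positive on `[-1, 1]`** (principal cell + `of_principal`).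
[cite: Weil1952FormulesExplicites, (11) pp. 261–262] -/
theorem forall_weilPositivityOnChar_one_mod_eighteen (χ : DirichletCharacter ℂ 18) : WeilPositivityOnChar χ 1 :=
  WeilPositivityOnChar.of_principal (by norm_num) one_pos PrincipalMod18.weilPositivityOnChar_one_principal_mod_eighteen χ

/-- ★ **`U(32)`: every Dirichlet character mod 32 is Weil-positive on `[-1, 1]`** (principal cell + `of_principal`).
[cite: Weil1952FormulesExplicites, (11) pp. 261–262] -/
theorem forall_weilPositivityOnChar_one_mod_thirtyTwo (χ : DirichletCharacter ℂ 32) : WeilPositivityOnChar χ 1 :=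
  WeilPositivityOnChar.of_principal (by norm_num) one_pos PrincipalMod32.weilPositivityOnChar_one_principal_mod_thirtyTwo χ

/-- ★★★ **THE COMPLETE DECISION AT `t = 1`.**  For every modulus `q ≥ 2`: EVERY Dirichlet character mod `q` is Weil-positive on
`[-1, 1]` if and only if `q` is NOT one of the 42 moduli
`2, …, 17, 19, …, 23, 25, …, 29, 31, 33, 35, 37, 39, 41, 43, 47, 49, 53, 55, 59, 61, 67, 71, 73` (on which the principal character fails).
[cite: Weil1952FormulesExplicites, (11) pp. 261–262 and the «lemme» p. 262] -/
theorem forall_weilPositivityOnChar_one_iff_not_mem (hq2 : 2 ≤ q) :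
    (∀ χ : DirichletCharacter ℂ q, WeilPositivityOnChar χ 1) ↔
      q ∉ ({2, 3, 4, 5, 6, 7, 8, 9, 10, 11, 12, 13, 14, 15, 16, 17, 19, 20, 21, 22, 23, 25, 26, 27, 28, 29, 31, 33, 35, 37,
        39, 41, 43, 47, 49, 53, 55, 59, 61, 67, 71, 73} : Finset ℕ) := by
  by_cases h18 : q = 18
  · subst h18
    exact ⟨fun _ ↦ by decide, fun _ χ ↦ forall_weilPositivityOnChar_one_mod_eighteen χ⟩
  by_cases h32 : q = 32
  · subst h32
    exact ⟨fun _ ↦ by decide, fun _ χ ↦ forall_weilPositivityOnChar_one_mod_thirtyTwo χ⟩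
  exact forall_weilPositivityOnChar_one_iff hq2 h18 h32

/-- **The failing set is exactly where the principal character fails**: for `q ≥ 2`, some character mod `q` fails Weil positivity
on `[-1, 1]` iff the principal one does, iff `q ∈ F`. [cite: Weil1952FormulesExplicites, (11) pp. 261–262] -/
theorem exists_not_weilPositivityOnChar_one_iff_mem (hq2 : 2 ≤ q) :
    (∃ χ : DirichletCharacter ℂ q, ¬ WeilPositivityOnChar χ 1) ↔
      q ∈ ({2, 3, 4, 5, 6, 7, 8, 9, 10, 11, 12, 13, 14, 15, 16, 17, 19, 20, 21, 22, 23, 25, 26, 27, 28, 29, 31, 33, 35, 37,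
        39, 41, 43, 47, 49, 53, 55, 59, 61, 67, 71, 73} : Finset ℕ) := by
  have h := forall_weilPositivityOnChar_one_iff_not_mem hq2
  constructor
  · rintro ⟨χ, hχ⟩
    by_contra hF
    exact hχ (h.2 hF χ)
  · intro hF
    exact ⟨1, not_weilPositivityOnChar_one_principal hF⟩

end UniformFloor

end Summit.Ventures.WeilGRH

end
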